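import Summits.Ventures.ManinGamma.GLFull

/-!
# R2 Step 7 / GL-d in abstract form: a «period homomorphism» whose level set is congruence has `P(Γ₁(N)) ⊆ Λ`

Blind cell `pub-manin-gamma0`, seat p3 (generation 2).  Paper reference: `proofs/GL_congruence_kernel_p3.md` Cor. GL-b/GL-d and
`proofs/R2_UBD_Honda_lattice_p3.md` Step 7.  Abstract setting: `B` a commutative group (the torus `ℂ/…` or just `ℂ` written multiplicatively),
`P : Γ₀(N) →* B` a homomorphism (the period map `γ ↦ P_f(γ)`), `Λ ≤ B` a subgroup (the Néron lattice `𝓛(A)`).  Hypotheses: `P` kills every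
trace-2 element of `Γ₀(N)` (periods of parabolic elements vanish, T1_lead 2.1(c)), and the level set `Γ_Λ := {γ ∈ Γ₀(N) : P γ ∈ Λ}` contains a
principal congruence subgroup `Γ(M)`, `M ≥ 1` (this is what UBD delivers in R2 Step 6).  Conclusion (`map_Gamma1_le`): `P(γ) ∈ Λ` for every
`γ ∈ Γ₁(N)`, i.e. `Λ₁ = P(Γ₁(N)) ⊆ Λ`.  The proof is Theorem GL (`ManinGamma.GLFull.Gamma1_le_of_Gamma_le'`).  No definitions are introduced.
-/

namespace ManinGamma
namespace PeriodStep

open scoped MatrixGroups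

/-- **R2 Step 7 (abstract).**  If `P : Γ₀(N) →* B` kills the trace-2 elements of `Γ₀(N)` and `{γ : P γ ∈ Λ} ⊇ Γ(M)` for some `M ≥ 1`, then
`P(Γ₁(N)) ⊆ Λ`. -/
theorem map_Gamma1_le {N M : ℕ} (hN : 0 < N) (hM : 0 < M) {B : Type*} [CommGroup B]
    (P : CongruenceSubgroup.Gamma0 N →* B) (Λ : Subgroup B)
    (hpar : ∀ γ : CongruenceSubgroup.Gamma0 N, ((γ : SL(2, ℤ)) : Matrix (Fin 2) (Fin 2) ℤ).trace = 2 → P γ ∈ Λ)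
    (hcong : ∀ γ : SL(2, ℤ), γ ∈ CongruenceSubgroup.Gamma M →
      ∃ h : γ ∈ CongruenceSubgroup.Gamma0 N, P ⟨γ, h⟩ ∈ Λ)
    (γ : SL(2, ℤ)) (hγ : γ ∈ CongruenceSubgroup.Gamma1 N) :
    P ⟨γ, CongruenceSubgroup.Gamma1_in_Gamma0 N hγ⟩ ∈ Λ := by
  -- the level set, as a subgroup of SL(2,ℤ)
  let Γ' : Subgroup SL(2, ℤ) := (Λ.comap P).map (CongruenceSubgroup.Gamma0 N).subtype
  have hmem : ∀ δ : SL(2, ℤ), δ ∈ Γ' ↔ ∃ h : δ ∈ CongruenceSubgroup.Gamma0 N, P ⟨δ, h⟩ ∈ Λ := by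
    intro δ
    constructor
    · rintro ⟨⟨δ', hδ'⟩, h1, h2⟩
      simp only [Subgroup.coe_subtype] at h2
      subst h2
      exact ⟨hδ', h1⟩
    · rintro ⟨h, hP⟩
      exact ⟨⟨δ, h⟩, hP, rfl⟩
  have hΓ : CongruenceSubgroup.Gamma M ≤ Γ' := fun δ hδ => (hmem δ).mpr (hcong δ hδ)
  have hparΓ : ∀ δ : SL(2, ℤ), δ ∈ CongruenceSubgroup.Gamma0 N → (δ : Matrix (Fin 2) (Fin 2) ℤ).trace = 2 → δ ∈ Γ' :=
    fun δ h1 h2 => (hmem δ).mpr ⟨h1, hpar ⟨δ, h1⟩ h2⟩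
  have key := GLFull.Gamma1_le_of_Gamma_le' hN hM Γ' hΓ hparΓ hγ
  obtain ⟨h, hP⟩ := (hmem γ).mp key
  exact hP

/-- Additive version (the lattice `Λ ⊆ ℂ` written additively): same statement with `P : Γ₀(N) →* Multiplicative A`. -/
theorem map_Gamma1_le_additive {N M : ℕ} (hN : 0 < N) (hM : 0 < M) {A : Type*} [AddCommGroup A]
    (P : CongruenceSubgroup.Gamma0 N →* Multiplicative A) (Λ : AddSubgroup A)
    (hpar : ∀ γ : CongruenceSubgroup.Gamma0 N, ((γ : SL(2, ℤ)) : Matrix (Fin 2) (Fin 2) ℤ).trace = 2 →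
      (P γ).toAdd ∈ Λ)
    (hcong : ∀ γ : SL(2, ℤ), γ ∈ CongruenceSubgroup.Gamma M →
      ∃ h : γ ∈ CongruenceSubgroup.Gamma0 N, (P ⟨γ, h⟩).toAdd ∈ Λ)
    (γ : SL(2, ℤ)) (hγ : γ ∈ CongruenceSubgroup.Gamma1 N) :
    (P ⟨γ, CongruenceSubgroup.Gamma1_in_Gamma0 N hγ⟩).toAdd ∈ Λ :=
  map_Gamma1_le hN hM P (Λ.toSubgroup) hpar hcong γ hγ

end PeriodStep
end ManinGamma
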